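import Mathlib
import HarnessLib
import Summits.ValiantsHypothesis.ValiantsHypothesis.Theses.MonotoneRestoration
import Literature.Computability.AlgebraicComplexity.ArithCircuit
import Literature.Computability.AlgebraicComplexity.ArithCircuitProofs
import Literature.Computability.AlgebraicComplexity.MonotoneStructure
import Literature.Computability.AlgebraicComplexity.PermanentIrreducible
import Literature.ModelTheory.FiniteModelTheory.CkEquiv
import Summits.ValiantsHypothesis.ValiantsHypothesis.Theorems.MonotoneRestorationMonotoneRestorationQPCosetCount
import Summits.ValiantsHypothesis.ValiantsHypothesis.Theorems.MonotoneRestorationMonotoneRestorationQPSymmetricLB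
import Summits.ValiantsHypothesis.ValiantsHypothesis.Theorems.MonotoneRestorationMonotoneRestorationQPSupportSymmetrisation
import Summits.ValiantsHypothesis.ValiantsHypothesis.Theorems.MonotoneRestorationMonotoneRestorationQPSparseRegime
import Summits.ValiantsHypothesis.ValiantsHypothesis.Theorems.MonotoneRestorationMonotoneRestorationQPBeta
import Literature.Computability.AlgebraicComplexity.SymmetricArithCircuit
import Literature.Computability.AlgebraicComplexity.DawarWilsenach2025Proofs
import Literature.GroupTheory.PermutationGroups.SmallIndexSubgroups
import Summits.ValiantsHypothesis.ValiantsHypothesis.Theorems.MonotoneRestorationQP.Negative.LoadBearing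
import Summits.ValiantsHypothesis.ValiantsHypothesis.Theorems.MonotoneRestorationMonotoneRestorationQPPermSupportCount

/-! TTRL-lite variant V19129 of stmt-ValiantsHypothesis-15886 -/

-- `Summit.ValiantsHypothesis.ValiantsHypothesis.…` is the tree's mandated single-conjunct layout
-- (Sub = Summit), so the duplicated namespace component is intended.
set_option linter.dupNamespace false

namespace Summit.ValiantsHypothesis.ValiantsHypothesis.Theorems

open Summit.ValiantsHypothesis.ValiantsHypothesis.Theses.MonotoneRestoration
open Literature.Computability.AlgebraicComplexity

/-- **TTRL-lite variant V19129 of `stub_esymmRowSums_structure` (stmt-ValiantsHypothesis-15886).**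
Exact CDGM form of the row-degree bound: for every row set `t`, the product of the row sums
`∏_{i ∈ t} R_i`, `R_i = Σ_j x_{i,j}`, over `ℝ≥0` is *ordered with row set exactly `t`*
(`IsOrdered t`): every monomial in its support has row degrees equal to the indicator of `t`
(row degree `= 1` on `t`, `= 0` off `t`, not merely `≤ 1`).
Proof: induction on `t`; the empty product is `1` with support `{0}`; for `insert a t`,
`support (f * g) ⊆ support f + support g`, a monomial of `R_a` is a single variable `x_{a,j}`
(`support_sum`, `support_X`), and row degrees are additive (`rowDegrees_add`,
`rowDegrees_single`). [folklore] -/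
theorem stub_esymmRowSums_structure_var19129 :
    ∀ (n : ℕ) (t : Finset (Fin n)), Literature.Computability.AlgebraicComplexity.IsOrdered t
      (∏ i ∈ t, ∑ j : Fin n, (MvPolynomial.X (i, j) : MvPolynomial (Fin n × Fin n) NNReal)) := by
  classical
  intro n t
  induction t using Finset.induction_on with
  | empty =>
    intro m hm i
    rw [Finset.prod_empty, MvPolynomial.support_one, Finset.mem_singleton] at hm
    simp [hm]
  | insert a t ha ih =>
    intro m hm i
    rw [Finset.prod_insert ha] at hm
    obtain ⟨m₁, hm₁, m₂, hm₂, rfl⟩ := Finset.mem_add.1 (MvPolynomial.support_mul _ _ hm)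
    obtain ⟨j, -, hj⟩ := Finset.mem_biUnion.1 (MvPolynomial.support_sum hm₁)
    rw [MvPolynomial.support_X, Finset.mem_singleton] at hj
    subst hj
    have h₂ := ih m₂ hm₂ i
    rw [rowDegrees_add, rowDegrees_single, Finsupp.add_apply, h₂]
    by_cases hi : i = a
    · subst hi
      rw [if_neg ha, Finsupp.single_eq_same, if_pos (Finset.mem_insert_self _ _)]
    · rw [Finsupp.single_eq_of_ne hi, zero_add]
      by_cases hit : i ∈ t
      · rw [if_pos hit, if_pos (Finset.mem_insert_of_mem hit)]
      · rw [if_neg hit, if_neg (by simp [Finset.mem_insert, hi, hit])]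

end Summit.ValiantsHypothesis.ValiantsHypothesis.Theorems
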